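import Mathlib
import Literature.NumberTheory.Transcendental.KZCalculus
import Literature.NumberTheory.Transcendental.KZCalculusProofs
import Literature.NumberTheory.Transcendental.KZLogCalculusProofs
import Literature.NumberTheory.Transcendental.KZSemiCanonicalReductionProofs

/-!
# `LegendreCubicForm` (stmt-KontsevichZagierPeriods-3521), line `Sketch (hat-box chart)`:
# stub `stub_heightNewtonLeibniz` (M2, height integration)

The flat representation `p = [(0,∞) × (0,1), 4/(1+u²)]` of the line (coordinates `w 0 = u`,
`w 1 = z`; the integrand does not depend on the height `z`) is KZ-equivalent to the half-line
representation `q = [(0,∞), 4/(1+u²)]`, which exists.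

Route (moves only, all from the Literature calculus):
* `q` exists (`exists_halfLineRep`): the ray `{0 < x 0}` is `ℚ`-semialgebraic
  (`isSemialgebraic_setOf_eval_pos (X 0)`), the integrand is the quotient of `ℚ`-polynomials
  `4 / (1 + X 0 ^ 2)` (`isSemialgebraicFunOn_aeval_div_aeval`), integrability is Mathlib's
  `integrable_inv_one_add_sq` transported to `Fin 1 → ℝ` (`volume_preserving_funUnique`);
* ONE Newton–Leibniz move (`KZ.IntegralRep.equivalent_slab q 0`): `q ∼ q.slab 0 =
  [(0,∞) × [0,1], 4/(1+u²)]` (primitive `F(u,z) = z · 4/(1+u²)`, edges `a ≡ 0 ≤ b ≡ 1`);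
* the open half-strip `p.domain` and the closed slab differ by (subsets of) the two NULL faces
  `{z = 0} ∪ {z = 1}` (`KZ.volume_setOf_last_eq_zero`) and the integrands agree on the overlap,
  so `[p] − [q.slab 0] ∈ relations` (`KZ.of_sub_of_mem_relations_of_null`);
* compose (`KZ.Equivalent.trans/symm`).

No definitions are introduced. References: M. Kontsevich, D. Zagier, *Periods* (2001), §1.2,
rules (1) and (3).
-/

noncomputable section

namespace Summit.KontsevichZagierPeriods.UnfoldedStokes.LegendreCubicFormLine

open Set MeasureTheory
open Literature.NumberTheory.Transcendental

/-- **The half-line representation `[(0,∞), 4/(1+x²)]` exists**: the ray is `ℚ`-semialgebraic,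
the integrand is a quotient of `ℚ`-polynomials with non-vanishing denominator, and it is
absolutely integrable (even on `ℝ`, `integrable_inv_one_add_sq`).
[cite: KontsevichZagier2001, §1.1] -/
theorem exists_halfLineRep : ∃ q : KZ.IntegralRep 1, q.domain = {x : Fin 1 → ℝ | 0 < x 0} ∧
    q.integrand = (fun x : Fin 1 → ℝ => 4 / (1 + x 0 ^ 2)) := by
  have hσ : Literature.ModelTheory.ExponentialFields.IsSemialgebraic ℚ
      {x : Fin 1 → ℝ | 0 < x 0} := by
    simpa using Literature.ModelTheory.ExponentialFields.isSemialgebraic_setOf_eval_pos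
      (k := ℚ) (R := ℝ) (MvPolynomial.X (0 : Fin 1) : MvPolynomial (Fin 1) ℚ)
  have hf : IsSemialgebraicFunOn ℚ {x : Fin 1 → ℝ | 0 < x 0}
      (fun x : Fin 1 → ℝ => 4 / (1 + x 0 ^ 2)) := by
    have h := isSemialgebraicFunOn_aeval_div_aeval hσ
      (4 : MvPolynomial (Fin 1) ℚ) (1 + MvPolynomial.X 0 ^ 2) (fun x _ => by
        simp only [map_add, map_one, map_pow, MvPolynomial.aeval_X]
        positivity)
    exact h.congr fun x _ => by
      simp only [map_add, map_one, map_pow, MvPolynomial.aeval_X, map_ofNat]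
  have hi : IntegrableOn (fun x : Fin 1 → ℝ => 4 / (1 + x 0 ^ 2)) {x : Fin 1 → ℝ | 0 < x 0} := by
    refine Integrable.integrableOn ?_
    have hg : Integrable (fun t : ℝ => 4 / (1 + t ^ 2)) := by
      refine (integrable_inv_one_add_sq.const_mul 4).congr
        (Filter.Eventually.of_forall fun t => ?_)
      simp only [div_eq_mul_inv]
    exact ((volume_preserving_funUnique (Fin 1) ℝ).integrable_comp_emb
      (MeasurableEquiv.measurableEmbedding _)).mpr hg
  exact ⟨⟨{x | 0 < x 0}, fun x => 4 / (1 + x 0 ^ 2), hσ, hf, hi⟩, rfl, rfl⟩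

/-- **Null faces.** A representation `p` on the open half-strip `(0,∞) × (0,1)` with integrand
`≡ 4/(1+u²)` there and the slab `q.slab 0 = [(0,∞) × [0,1], 4/(1+u²)]` at level `0` over the
half-line representation `q` differ by a relation: the domains differ by (subsets of) the two
null faces `{z = 0} ∪ {z = 1}`, and the integrands agree on the overlap
(`KZ.of_sub_of_mem_relations_of_null`). [cite: KontsevichZagier2001, §1.2 rule (1)] -/
theorem equivalent_slab_halfLine (p : KZ.IntegralRep 2) (q : KZ.IntegralRep 1)
    (hpd : p.domain = {w : Fin 2 → ℝ | 0 < w 0 ∧ 0 < w 1 ∧ w 1 < 1})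
    (hpi : Set.EqOn p.integrand (fun w : Fin 2 → ℝ => 4 / (1 + w 0 ^ 2)) p.domain)
    (hqd : q.domain = {x : Fin 1 → ℝ | 0 < x 0})
    (hqi : q.integrand = (fun x : Fin 1 → ℝ => 4 / (1 + x 0 ^ 2))) :
    KZ.Equivalent p (q.slab 0) := by
  have hlast : (Fin.last 1 : Fin 2) = 1 := rfl
  have hinit0 : ∀ z : Fin 2 → ℝ, Fin.init z 0 = z 0 := fun z => rfl
  refine KZ.of_sub_of_mem_relations_of_null p (q.slab 0) ?_ ?_ ?_
  · -- `half-strip ⊆ slab`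
    rw [Set.sdiff_eq_empty.mpr ?_, measure_empty]
    intro w hw
    rw [hpd] at hw
    obtain ⟨h0, h1, h2⟩ := hw
    simp only [KZ.IntegralRep.domain_slab, KZ.IntegralRep.slabDomain, mem_setOf_eq, Nat.cast_zero,
      zero_add, hqd, hinit0, hlast]
    exact ⟨h0, h1.le, h2.le⟩
  · -- `slab \ half-strip ⊆ {z = 0} ∪ {z = 1}`, a null set
    refine measure_mono_null (t := {z | z (Fin.last 1) = 0} ∪ {z | z (Fin.last 1) = 1}) ?_
      (measure_union_null (KZ.volume_setOf_last_eq_zero 0) (KZ.volume_setOf_last_eq_zero 1))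
    rintro z ⟨hz1, hz2⟩
    simp only [KZ.IntegralRep.domain_slab, KZ.IntegralRep.slabDomain, mem_setOf_eq, Nat.cast_zero,
      zero_add, hqd, hinit0, hlast] at hz1
    obtain ⟨hu, h0, h1⟩ := hz1
    rw [hpd] at hz2
    simp only [mem_setOf_eq, not_and, not_lt] at hz2
    simp only [mem_union, mem_setOf_eq, hlast]
    rcases h0.eq_or_lt with h | h
    · exact Or.inl h.symm
    · exact Or.inr (le_antisymm h1 (hz2 hu h))
  · -- the integrands are both `4/(1+u²)` on the overlap
    intro z hz
    rw [KZ.IntegralRep.integrand_slab, hqi, hpi hz.1]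
    exact rfl

/-- **M2, HEIGHT INTEGRATION.** The flat representation `[(0,∞) × (0,1), 4/(1+u²)]` is
KZ-equivalent to `[(0,∞), 4/(1+u²)]`, which EXISTS — null faces `z ∈ {0,1}` (rule (1) with a null
set), then ONE Newton–Leibniz move along the last coordinate over the base `(0,∞)` with
`a ≡ 0 ≤ b ≡ 1` and the polynomial-in-`z` primitive `F(u,z) = 4z/(1+u²)`
(`KZ.IntegralRep.equivalent_slab`). [cite: KontsevichZagier2001, §1.2 rule (3)] -/
theorem stub_heightNewtonLeibniz :
    ∀ (p : KZ.IntegralRep 2), p.domain = {w : Fin 2 → ℝ | 0 < w 0 ∧ 0 < w 1 ∧ w 1 < 1} →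
      Set.EqOn p.integrand (fun w : Fin 2 → ℝ => 4 / (1 + w 0 ^ 2)) p.domain →
      ∃ q : KZ.IntegralRep 1, q.domain = {x : Fin 1 → ℝ | 0 < x 0} ∧
        q.integrand = (fun x : Fin 1 → ℝ => 4 / (1 + x 0 ^ 2)) ∧ KZ.Equivalent p q := by
  intro p hpd hpi
  obtain ⟨q, hqd, hqi⟩ := exists_halfLineRep
  exact ⟨q, hqd, hqi,
    (equivalent_slab_halfLine p q hpd hpi hqd hqi).trans (q.equivalent_slab 0).symm⟩

end Summit.KontsevichZagierPeriods.UnfoldedStokes.LegendreCubicFormLine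

end
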